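import Literature.NumberTheory.EllipticCurves.TwoDescentOneRootAdjoinRoot
import Literature.NumberTheory.EllipticCurves.KubertTateFive
import Mathlib.RingTheory.Polynomial.RationalRoot
import Mathlib.Algebra.Polynomial.SpecificDegree
import HarnessLib

/-!
# The cubic `2`-division field of `E_{13/14}` and the generic `2`-descent rank bound on it

Topic `NumberTheory/EllipticCurves`; first INSTANCE-side file of the generic `2`-descent
(`TwoDescentOneRoot{,Kernel,Rank,CubicField,AdjoinRoot}.lean`, Cassels LMSST 24 §15). Everything PROVED; no named
fact, no `sorry`, no definition.

`E_{13/14} = kubertTateFive 13 14 = [1, −182, −2548, 0, 0]` is the rank-`2` Kubert–Tate curve whose door at `5` is in the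
tree (`KubertTate1314ShaFive`: `t₅ = 0`, `Ш[5] = 0`); it has NO rational `2`-torsion, so none of the tree's isogeny
`2`-descents applies to it — it is the first target of the generic `2`-descent (seat bsd-line-spt-p1 g25, census
Z10-VERDICT-g25). Here:

* `b₂_1314`, `b₄_1314`, `b₆_1314` — `b₂ = −727`, `b₄ = −2548`, `b₆ = 6492304`;
* **`irreducible_twoDivision_1314`** — the monic `2`-division cubic `X³ − (727/4)X² − 1274X + 1623076` is irreducible
  over `ℚ`: a rational root `r` gives the integer `4r` (monic integer cubic `Y³ − 727Y² − 20384Y + 103876864`,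
  rational root theorem), and that cubic has no root modulo `3`;
* **`pow_mordellWeilRank_1314_le_card`** — the generic `2`-descent rank bound for `E_{13/14}` over its cubic
  `2`-division field `L = ℚ[X]/(Ψ₂/4)`: `2 ^ rank E_{13/14}(ℚ) ≤ #T` for every finite `T ⊆ Lˣ/Lˣ²` containing the
  values `x(P) − Θ` of the Cassels map (Mordell–Weil finiteness from the tree's `module_finite_point_holds`).
  The arithmetic bound `T` (square-norm classes of `L(S, 2)`, `S ⊇ {2, 7, 13, 2029}`) is the remaining input.

## References

* [Cassels1991LecturesEllipticCurves] J. W. S. Cassels, *Lectures on Elliptic Curves*, LMSST 24 (1991), §15.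
* [Kubert1976] D. S. Kubert, *Universal bounds on the torsion of elliptic curves*, Table 3 (`N = 5`).
-/

noncomputable section

open scoped Classical
open Polynomial

namespace Literature.NumberTheory.EllipticCurves.KubertTate1314TwoDivision

open WeierstrassCurve WeierstrassCurve.Affine WeierstrassCurve.Affine.Point

/-- `b₂(E_{13/14}) = −727`. [cite: Kubert1976, Table 3 (N = 5)] -/
theorem b₂_1314 : (kubertTateFive (13 : ℚ) 14).b₂ = -727 := by
  rw [WeierstrassCurve.b₂]; simp [kubertTateFive]; norm_num

/-- `b₄(E_{13/14}) = −2548`. [cite: Kubert1976, Table 3 (N = 5)] -/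
theorem b₄_1314 : (kubertTateFive (13 : ℚ) 14).b₄ = -2548 := by
  rw [WeierstrassCurve.b₄]; simp [kubertTateFive]; norm_num

/-- `b₆(E_{13/14}) = 6492304`. [cite: Kubert1976, Table 3 (N = 5)] -/
theorem b₆_1314 : (kubertTateFive (13 : ℚ) 14).b₆ = 6492304 := by
  rw [WeierstrassCurve.b₆]; simp [kubertTateFive]; norm_num

/-- The integer cubic `Y³ − 727Y² − 20384Y + 103876864` (`= 64 · (Ψ₂/4)(Y/4)`) has no integer root: it has no root
modulo `3`. [cite: Cassels1991LecturesEllipticCurves, §15 (F irreducible)] -/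
theorem int_cubic_ne_zero (m : ℤ) : m ^ 3 - 727 * m ^ 2 - 20384 * m + 103876864 ≠ 0 := by
  intro h
  have h3 := congrArg (Int.cast : ℤ → ZMod 3) h
  push_cast at h3
  generalize (m : ZMod 3) = y at h3
  revert y
  decide

/-- **The `2`-division cubic of `E_{13/14}` is irreducible over `ℚ`** (`E_{13/14}(ℚ)[2] = 0`): the monic cubic
`Ψ₂/4 = X³ − (727/4)X² − 1274X + 1623076` has no rational root (for a root `r`, `4r` is an integer root of
`Y³ − 727Y² − 20384Y + 103876864`, impossible mod `3`), hence is irreducible (degree `3`).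
[cite: Cassels1991LecturesEllipticCurves, §15 (the case F irreducible)] -/
theorem irreducible_twoDivision_1314 :
    Irreducible (X ^ 3 + C ((kubertTateFive (13 : ℚ) 14).b₂ / 4) * X ^ 2 +
      C ((kubertTateFive (13 : ℚ) 14).b₄ / 2) * X + C ((kubertTateFive (13 : ℚ) 14).b₆ / 4) : ℚ[X]) := by
  refine Polynomial.irreducible_of_degree_le_three_of_not_isRoot ?_ ?_
  · rw [natDegree_twoDivision_monic]; decide
  · intro r hr
    rw [IsRoot, b₂_1314, b₄_1314, b₆_1314] at hr
    simp only [eval_add, eval_mul, eval_pow, eval_X, eval_C] at hr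
    -- `η = 4r` is a root of a monic integer cubic, hence an integer
    have hmon : (X ^ 3 - C 727 * X ^ 2 - C 20384 * X + C 103876864 : ℤ[X]).Monic := by monicity!
    have hroot : aeval (4 * r) (X ^ 3 - C 727 * X ^ 2 - C 20384 * X + C 103876864 : ℤ[X]) = 0 := by
      simp only [map_add, map_sub, map_mul, map_pow, aeval_X, aeval_C, algebraMap_int_eq,
        Int.coe_castRingHom, Int.cast_ofNat]
      linear_combination (64 : ℚ) * hr
    obtain ⟨m, hm⟩ := isInteger_of_is_root_of_monic hmon hroot
    have hm' : (m : ℚ) = 4 * r := by simpa using hm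
    have hq : (m : ℚ) ^ 3 - 727 * (m : ℚ) ^ 2 - 20384 * (m : ℚ) + 103876864 = 0 := by
      rw [hm']; linear_combination (64 : ℚ) * hr
    have hz : m ^ 3 - 727 * m ^ 2 - 20384 * m + 103876864 = 0 := by exact_mod_cast hq
    exact int_cubic_ne_zero m hz

/-- **The generic `2`-descent rank bound for `E_{13/14}`** over its cubic `2`-division field `L = ℚ[X]/(Ψ₂/4)`
(`Θ` the class of `X`): for every finite `T ⊆ Lˣ/Lˣ²` containing all values `x(P) − Θ` of the Cassels map on
`E_{13/14}(ℚ)`, `2 ^ rank E_{13/14}(ℚ) ≤ #T`. (The instance binders `Fact (Irreducible _)`, `CharZero L`, `(E_L).IsElliptic`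
are discharged by `irreducible_twoDivision_1314`, `charZero_of_injective_algebraMap`, `inferInstance`; stated for an arbitrary
`DecidableEq ℚ`, as the group law of `E(ℚ)` is.)
[cite: Cassels1991LecturesEllipticCurves, §15 Theorem (finite basis) with Lemmas 1–2] -/
theorem pow_mordellWeilRank_1314_le_card [inst : DecidableEq ℚ]
    [Fact (Irreducible (X ^ 3 + C ((kubertTateFive (13 : ℚ) 14).b₂ / 4) * X ^ 2 +
      C ((kubertTateFive (13 : ℚ) 14).b₄ / 2) * X + C ((kubertTateFive (13 : ℚ) 14).b₆ / 4) : ℚ[X]))]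
    [CharZero (AdjoinRoot (X ^ 3 + C ((kubertTateFive (13 : ℚ) 14).b₂ / 4) * X ^ 2 +
      C ((kubertTateFive (13 : ℚ) 14).b₄ / 2) * X + C ((kubertTateFive (13 : ℚ) 14).b₆ / 4) : ℚ[X]))]
    [((kubertTateFive (13 : ℚ) 14).baseChange (AdjoinRoot (X ^ 3 + C ((kubertTateFive (13 : ℚ) 14).b₂ / 4) * X ^ 2 +
      C ((kubertTateFive (13 : ℚ) 14).b₄ / 2) * X + C ((kubertTateFive (13 : ℚ) 14).b₆ / 4) : ℚ[X]))).IsElliptic]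
    (T : Finset (Additive (SqUnits (AdjoinRoot (X ^ 3 + C ((kubertTateFive (13 : ℚ) 14).b₂ / 4) * X ^ 2 +
      C ((kubertTateFive (13 : ℚ) 14).b₄ / 2) * X + C ((kubertTateFive (13 : ℚ) 14).b₆ / 4) : ℚ[X])))))
    (hT : ∀ P : (kubertTateFive (13 : ℚ) 14).toAffine.Point,
      casselsMap (V := kubertTateFive (13 : ℚ) 14) _ (isTwoTorsionX_root (kubertTateFive (13 : ℚ) 14)) P ∈ T) :
    2 ^ (kubertTateFive (13 : ℚ) 14).mordellWeilRank ≤ T.card := by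
  -- the tree's group law on `E(ℚ)` (Mordell–Weil, `mordellWeilRank`) is elaborated against the classical `DecidableEq ℚ`
  obtain rfl : inst = (fun a b ↦ Classical.propDecidable (a = b)) := Subsingleton.elim _ _
  letI : DecidableEq ℚ := fun a b ↦ Classical.propDecidable (a = b)
  haveI : (kubertTateFive (13 : ℚ) 14).IsElliptic :=
    isElliptic_kubertTateFive_rat (by norm_num) (by norm_num)
  haveI : Module.Finite ℤ (kubertTateFive (13 : ℚ) 14).toAffine.Point := by
    convert (kubertTateFive (13 : ℚ) 14).module_finite_point_holds
  exact pow_mordellWeilRank_le_card_of_irreducible (kubertTateFive (13 : ℚ) 14) T hT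

end Literature.NumberTheory.EllipticCurves.KubertTate1314TwoDivision

end
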